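import Literature.InformationTheory.QuantumCodes.LocalCodeTradeoffTorus
import HarnessLib

/-!
# Haah–Preskill 2012, Theorem 1 (logical-operator tradeoff), stabilizer codes on the torus — proof

J. Haah, J. Preskill, *Logical-operator tradeoff for local quantum codes*, Phys. Rev. A 86 (2012) 032308 =
arXiv:1011.3529 [HaahPreskill2012]. Setting (§2, chunk p0004 L36): «the qubits reside at the vertices of a
`D`-dimensional hypercubic lattice (with either open or periodic boundary conditions), and … each generator acts
nontrivially only inside a hypercube (containing `w^D` vertices) with linear size `w`». «Theorem 1 (Tradeoff Theorem
for local subsystem codes). For a local subsystem code in `D ≥ 2` dimensions with interaction range `w > 1` and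
distance `d ≫ w`, defined on a hypercubic lattice with linear size `L`, every dressed logical operator is equivalent
to an operator with weight `d̃` satisfying `d̃ d^{1/(D−1)} < c L^D`, where `c` is a constant depending on `w` and `D`.»
(chunk p0008 L1–8). Printed proof (p0008 L11–26): «we fill the lattice with hypercubes, separated by distance `w−1`,
such that each hypercube has linear size `l` [small enough to be correctable]. Thus no gauge generator acts
nontrivially on more than one hypercube, and each hypercube is correctable … we construct a gauge operator that cleans
all hypercubes simultaneously; thus `x̃ = x ∏ y_i` is equivalent to `x` and supported on the complement of the union
of hypercubes `M = ∪ M_i`. Therefore, the weight `d̃` of `x̃` is upper bounded by `|M^c|` …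
`|M^c| ≤ (w−1)D [l+(w−1)]^{D−1} L^D/[l+(w−1)]^D` … choosing `l` to be the largest integer such that a hypercube with
linear size `l` is known to be correctable, `l < (d/4(w−1)D)^{1/(D−1)}`.» For `D = 2`: «the tradeoff becomes
`d d̃ = O(L²)`» (p0003 L43); its use: Theorem 4, «Limitation on partial self correction» (p0013 L41).

THIS FILE PROVES the STABILIZER case (gauge group = stabilizer group, «dressed logical operator» = element of
`S̄⊥ ∖ S̄`, «equivalent» = equal modulo `S̄`) on the `D`-dimensional torus `(ℤ/L)^D` and, as a corollary, with open
boundary conditions, in the uniform form the printed proof delivers — ONE region `Y = M^c` supporting a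
representative of EVERY logical class:
`HaahPreskill2012_theorem1_stabilizer_torus (D w) (hD : 2 ≤ D) : ∃ c > 0, ∀ L n k d e S, HasLocalGeneratorsPeriodic e w S →
IsAdditiveCode S k d → ∃ Y, S ⊔ (S̄⊥ ⊓ 𝒫(Y)) = S̄⊥ ∧ |Y| · d^{1/(D−1)} ≤ c · n`, and the printed per-operator reading
`HaahPreskill2012_theorem1_stabilizer_torus'` (every `E ∈ S̄⊥` has `E' ≡ E (mod S̄)` with `wt(E') · d^{1/(D−1)} ≤ c n`).

## Proof (as printed, on the partition of `LocalCodeTradeoffTorus.lean`)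

The hypercubes `M_i` are the pure blocks of the BPT partition (all coordinates in block columns of the near-equal
cyclic periods, `BPTTorus.per`/`IsCorr`), of side `R` with every side-`R` hypercube correctable
(`BPTTorus.exists_correctable_cube`, the growth of Cor. 1: `d ≤ 4tD(R+2t)^{D−1}`); generators of range `t + 1 = w`
meet at most one block (`pureLab_separated`), so the union `M` is correctable (`isCorrectableRegion_of_fibers`) and
the Cleaning Lemma (`sup_sympDual_inf_supportedOn_compl_eq`) moves every logical operator onto
`Y = M^c = {some coordinate in a corridor column}`, `|Y| ≤ D · 3tQ · L^{D−1} ≤ 6tD · n/p` (`p = R + t` the period);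
with `d ≤ C_B p^{D−1}`: `|Y| d^{1/(D−1)} ≤ 6tD C_B^{1/(D−1)} n`. Degenerate regimes (`d ≤ 1`, torus smaller than `6t`,
blocks smaller than `5t`: `d ≤ C_B`, `Y` = everything; blocks outgrowing the torus: `Y` = complement of one
correctable hypercube, `|Y| ≤ 2tD L^{D−1}`, `d ≤ 2tD L^{D−1}`; `k = 0`: `Y = ∅`) are treated explicitly.

Deliberately NOT here: subsystem codes with non-abelian gauge group (the printed generality of Thm. 1 — no gauge
vocabulary in the tree; `TODO(general form)`), commuting-projector codes (Thm. 2), Thm. 3 (one thin slab, width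
`5(w−1)`), Thm. 4 (partial self-correction; needs the energy-barrier walk of `LocalCodeEnergyBarrier.lean` on a
network of strips).

## References

* [HaahPreskill2012] arXiv:1011.3529, read via `lit`: §2 setting (p0004 L36), Thm. 1 and proof (p0008 L1–26),
  `D = 2` reading (p0003 L43), Thm. 4 (p0013 L41).
* [BravyiPoulinTerhal2010] arXiv:0909.5200: the partition and «R ≥ d/(cw)» (pp. 2–3) — the machinery reused from
  `LocalCodeTradeoffTorus.lean`.

## Mathlib / tree search

Tree: `BPTTorus.{per, pstart, IsCorr, Close, badFin, card_badFin_le, cube, card_cube_eq, block_offset,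
pstart_le_of_per_eq, per_eq_of_close_of_not_isCorr, close_of_inCubePeriodic, card_filter_sub_mem,
exists_correctable_cube, dist_le_card_compl_of_isCorrectableRegion, pow_sub_pow_le, IsCorr.bad}`
(LocalCodeTradeoffTorus.lean); `fiber`, `isCorrectableRegion_of_fibers`, `IsCorrectableRegion.{mono, inf_le, of_card_lt}`
(CorrectableRegions.lean); `sup_sympDual_inf_supportedOn_compl_eq` (QuantumSingletonBound.lean). No prior
logical-operator-tradeoff declaration (`rg -i "Haah|tradeoff theorem|d̃"` over Literature/InformationTheory: none).
-/

namespace Literature.InformationTheory.QuantumCodes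

open Finset Module
open Classical

namespace HPTradeoff

open BPTTorus

noncomputable section

section Partition

variable {D L n : ℕ} (e : Fin n ≃ (Fin D → Fin L)) (Q t : ℕ)

/-- **The hypercubes `M_i`, as a labelling**: a qubit all of whose coordinates are block columns is labelled by its
block (the vector of period indices); corridor qubits are unlabelled. Column: definition.
[cite: HaahPreskill2012, §4 proof of Thm. 1 («we fill the lattice with hypercubes, separated by distance w−1»)] -/
def pureLab (q : Fin n) : Option (Fin D → ℕ) :=
  if ∀ j, ¬ IsCorr L Q t (e q j : ℕ) then some (fun j => per L Q (e q j : ℕ)) else none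

/-- **The region `M^c`**: qubits with at least one coordinate in a corridor column. Column: definition.
[cite: HaahPreskill2012, §4 proof of Thm. 1 («supported on the complement of the union of hypercubes M = ∪ M_i»)] -/
def InCorridor (q : Fin n) : Prop := ∃ j, IsCorr L Q t (e q j : ℕ)

variable {e Q t}

/-- The label of a block qubit is its block. [cite: HaahPreskill2012, §4 proof of Thm. 1] -/
theorem pureLab_eq_some_iff {q : Fin n} {P : Fin D → ℕ} :
    pureLab e Q t q = some P ↔ (∀ j, ¬ IsCorr L Q t (e q j : ℕ)) ∧ (fun j => per L Q (e q j : ℕ)) = P := by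
  unfold pureLab
  split_ifs with h
  · constructor
    · intro h'; exact ⟨h, Option.some.inj h'⟩
    · rintro ⟨-, h'⟩; rw [h']
  · constructor
    · intro h'; exact absurd h' (by simp)
    · rintro ⟨h', -⟩; exact absurd h' h

/-- A qubit is labelled iff it is not a corridor qubit. [cite: HaahPreskill2012, §4 proof of Thm. 1] -/
theorem isSome_pureLab_iff {q : Fin n} : (pureLab e Q t q).isSome ↔ ¬ InCorridor e Q t q := by
  unfold pureLab InCorridor
  split_ifs with h
  · simp only [Option.isSome_some, true_iff, not_exists]; exact h
  · simp only [Option.isSome_none, Bool.false_eq_true, false_iff, not_not]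
    by_contra h'
    exact h fun j hj => h' ⟨j, hj⟩

/-- Every block lies inside a hypercube of side `R` (`L ≤ Q(R+t)`).
[cite: HaahPreskill2012, §4 proof of Thm. 1 («each hypercube has linear size l»)] -/
theorem fiber_pureLab_subset_cube (hQ : 0 < Q) (hL : 0 < L) {R : ℕ} (hLQ : L ≤ Q * (R + t))
    (P : Fin D → ℕ) : ∃ o : Fin D → Fin L, fiber (pureLab e Q t) (some P) ⊆ cube e o R := by
  by_cases hne : (fiber (pureLab e Q t) (some P)).Nonempty
  · obtain ⟨q₀, hq₀⟩ := hne
    rw [mem_fiber, pureLab_eq_some_iff] at hq₀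
    have hP : ∀ j, per L Q (e q₀ j : ℕ) = P j := fun j => congrFun hq₀.2 j
    have hlt : ∀ j, pstart L Q (P j) < L := fun j =>
      lt_of_le_of_lt (pstart_le_of_per_eq hQ hL (hP j)).1 (e q₀ j).isLt
    refine ⟨fun j => ⟨pstart L Q (P j), hlt j⟩, fun q hq => ?_⟩
    rw [mem_fiber, pureLab_eq_some_iff] at hq
    rw [mem_cube]
    intro j
    have hPj : per L Q (e q j : ℕ) = P j := congrFun hq.2 j
    have hb := block_offset (p := R + t) hQ hL hLQ (hq.1 j) hPj
    have hval : sh e (fun j => ⟨pstart L Q (P j), hlt j⟩) q j = (e q j : ℕ) - pstart L Q (P j) :=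
      Fin.coe_sub_iff_le.2 (Fin.le_def.2 hb.1)
    rw [hval]
    omega
  · rw [Finset.not_nonempty_iff_eq_empty] at hne
    exact ⟨fun _ => ⟨0, hL⟩, by rw [hne]; exact empty_subset _⟩

/-- **«No gauge generator acts nontrivially on more than one hypercube»**: a generator of range `t + 1` meets at
most one block. [cite: HaahPreskill2012, §4 proof of Thm. 1] -/
theorem pureLab_separated {v : SympVec n} (hv : IsCubeLocalPeriodic e (t + 1) v) :
    ∀ q ∈ sympSupport v, ∀ q' ∈ sympSupport v, ∀ P P' : Fin D → ℕ,
      pureLab e Q t q = some P → pureLab e Q t q' = some P' → P = P' := by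
  obtain ⟨c, hc⟩ := hv
  intro q hq q' hq' P P' hP hP'
  rw [pureLab_eq_some_iff] at hP hP'
  rw [← hP.2, ← hP'.2]
  funext j
  exact per_eq_of_close_of_not_isCorr (hP.1 j) (hP'.1 j) (close_of_inCubePeriodic (hc q hq) (hc q' hq') j)

/-- **The union of the hypercubes is correctable** (each is, and they are decoupled).
[cite: HaahPreskill2012, §4 proof of Thm. 1 («a gauge operator that cleans all hypercubes simultaneously»)] -/
theorem isCorrectableRegion_blocks {ι : Type*} {g : ι → SympVec n} {S : Submodule (ZMod 2) (SympVec n)}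
    (hS : S = Submodule.span (ZMod 2) (Set.range g)) (hg : ∀ a, IsCubeLocalPeriodic e (t + 1) (g a))
    (hQ : 0 < Q) (hL : 0 < L) {R : ℕ} (hLQ : L ≤ Q * (R + t)) (hcube : ∀ o, IsCorrectableRegion S (cube e o R)) :
    IsCorrectableRegion S (univ.filter fun q => ¬ InCorridor e Q t q) := by
  have h := isCorrectableRegion_of_fibers (pureLab e Q t) g hS (fun a => pureLab_separated (hg a))
    (fun P => by
      obtain ⟨o, ho⟩ := fiber_pureLab_subset_cube (e := e) (t := t) hQ hL hLQ P
      exact (hcube o).mono ho)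
  refine h.mono fun q hq => ?_
  rw [mem_filter] at hq ⊢
  exact ⟨hq.1, isSome_pureLab_iff.2 hq.2⟩

/-- **`|M^c| ≤ D · (#corridor columns) · L^{D−1} ≤ 3tDQ · L^{D−1}`.**
[cite: HaahPreskill2012, §4 proof of Thm. 1 («|M^c| ≤ (w−1)D[l+(w−1)]^{D−1} L^D/[l+(w−1)]^D»)] -/
theorem card_filter_inCorridor_le (hQ : 0 < Q) (hL : 0 < L) (h2 : 2 * t * Q ≤ L) :
    #(univ.filter fun q => InCorridor e Q t q) ≤ D * (3 * t * Q) * L ^ (D - 1) := by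
  haveI : NeZero L := ⟨hL.ne'⟩
  set C : Finset (Fin L) := univ.filter fun s : Fin L => IsCorr L Q t (s : ℕ) with hC
  have hCb : #C ≤ 3 * t * Q := by
    refine le_trans (card_le_card fun s hs => ?_) (card_badFin_le (L := L) (t := t) hQ hL h2)
    rw [hC, mem_filter] at hs
    unfold badFin
    rw [mem_filter]
    exact ⟨mem_univ _, hs.2.bad⟩
  have hone : ∀ j : Fin D, #(univ.filter fun q : Fin n => IsCorr L Q t (e q j : ℕ)) = #C * L ^ (D - 1) := by
    intro j
    have h := card_filter_sub_mem (e := e) hL (fun _ => (0 : Fin L)) (fun i => if i = j then C else univ)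
    have hset : (univ.filter fun q : Fin n => IsCorr L Q t (e q j : ℕ)) =
        univ.filter fun q : Fin n => ∀ i, e q i - (fun _ => (0 : Fin L)) i ∈
          (fun i => if i = j then C else univ) i := by
      ext q
      simp only [mem_filter, mem_univ, true_and, sub_zero]
      constructor
      · intro hq i
        split_ifs with hi
        · rw [hi, hC, mem_filter]; exact ⟨mem_univ _, hq⟩
        · exact mem_univ _
      · intro hq
        have := hq j
        rw [if_pos rfl, hC, mem_filter] at this
        exact this.2
    rw [hset, h]
    have hprod : (∏ i, #((fun i => if i = j then C else (univ : Finset (Fin L))) i)) =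
        ∏ i : Fin D, (if i = j then #C else L) := by
      refine Finset.prod_congr rfl fun i _ => ?_
      by_cases hi : i = j
      · simp only [hi, if_true]
      · simp only [hi, if_false, card_univ, Fintype.card_fin]
    rw [hprod, Finset.prod_ite, Finset.prod_const, Finset.prod_const]
    have h1 : #(univ.filter fun i : Fin D => i = j) = 1 := by
      rw [Finset.filter_eq' univ j, if_pos (mem_univ _), card_singleton]
    have h2 : #(univ.filter fun i : Fin D => ¬ i = j) = D - 1 := by
      rw [Finset.filter_ne' univ j, card_erase_of_mem (mem_univ _), card_univ, Fintype.card_fin]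
    rw [h1, h2, pow_one]
  calc #(univ.filter fun q => InCorridor e Q t q)
      ≤ #((univ : Finset (Fin D)).biUnion fun j => univ.filter fun q : Fin n => IsCorr L Q t (e q j : ℕ)) := by
        refine card_le_card fun q hq => ?_
        rw [mem_filter] at hq
        obtain ⟨j, hj⟩ := hq.2
        rw [mem_biUnion]
        exact ⟨j, mem_univ _, by rw [mem_filter]; exact ⟨mem_univ _, hj⟩⟩
    _ ≤ ∑ j : Fin D, #(univ.filter fun q : Fin n => IsCorr L Q t (e q j : ℕ)) := card_biUnion_le
    _ = ∑ _j : Fin D, #C * L ^ (D - 1) := sum_congr rfl fun j _ => hone j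
    _ = D * (#C * L ^ (D - 1)) := by rw [sum_const, card_univ, Fintype.card_fin, smul_eq_mul]
    _ ≤ D * (3 * t * Q * L ^ (D - 1)) := by gcongr
    _ = D * (3 * t * Q) * L ^ (D - 1) := by ring

end Partition

/-! ### Assembly -/

section Assembly

variable {D L n : ℕ}

/-- `a^D − b^D ≤ (a − b)·D·a^{D−1}` for `b ≤ a` (telescoping; a private copy of the helper of
`LocalCodeTradeoffTorus.lean`). [folklore] -/
private theorem pow_sub_pow_le (a b : ℕ) (hab : b ≤ a) : ∀ D : ℕ, a ^ D - b ^ D ≤ (a - b) * (D * a ^ (D - 1))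
  | 0 => by simp
  | D + 1 => by
    have ih := pow_sub_pow_le a b hab D
    rw [Nat.add_sub_cancel]
    apply Nat.sub_le_iff_le_add'.2
    rcases Nat.eq_zero_or_pos D with hD | hD
    · subst hD; simp; omega
    · have haD : a * a ^ (D - 1) = a ^ D := by
        rw [← pow_succ']; congr 1; omega
      have h1 : a ^ D ≤ b ^ D + (a - b) * (D * a ^ (D - 1)) := Nat.sub_le_iff_le_add'.1 ih
      calc a ^ (D + 1) = a * a ^ D := by ring
        _ ≤ a * (b ^ D + (a - b) * (D * a ^ (D - 1))) := Nat.mul_le_mul_left _ h1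
        _ = a * b ^ D + (a - b) * (D * (a * a ^ (D - 1))) := by ring
        _ = (b + (a - b)) * b ^ D + (a - b) * (D * a ^ D) := by rw [haD]; congr 1; rw [Nat.add_sub_cancel' hab]
        _ = b ^ (D + 1) + (a - b) * b ^ D + (a - b) * (D * a ^ D) := by ring
        _ ≤ b ^ (D + 1) + (a - b) * a ^ D + (a - b) * (D * a ^ D) := by gcongr
        _ = b ^ (D + 1) + (a - b) * ((D + 1) * a ^ (D + 1 - 1)) := by rw [Nat.add_sub_cancel]; ring
/-- The whole lattice supports everything: `S̄ ⊔ (S̄⊥ ⊓ 𝒫(Λ)) = S̄⊥` for self-orthogonal `S̄`. [folklore] -/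
private theorem sup_inf_supportedOn_univ {S : Submodule (ZMod 2) (SympVec n)} (hself : IsSelfOrthogonal S) :
    S ⊔ (sympDual S ⊓ supportedOn (univ : Finset (Fin n))) = sympDual S := by
  have htop : supportedOn (univ : Finset (Fin n)) = ⊤ := by
    ext v
    simp only [Submodule.mem_top, iff_true]
    intro i hi
    exact absurd (mem_univ i) hi
  rw [htop, inf_top_eq]
  exact sup_eq_right.2 hself

/-- Cleaning onto the complement of a correctable region: `S̄ ⊔ (S̄⊥ ⊓ 𝒫(M^c)) = S̄⊥`.
[cite: HaahPreskill2012, §3 Lemma 3 (Cleaning Lemma) as used in the proof of Thm. 1] -/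
theorem sup_inf_supportedOn_compl_of_isCorrectableRegion {S : Submodule (ZMod 2) (SympVec n)}
    (hself : IsSelfOrthogonal S) {M : Finset (Fin n)} (hM : IsCorrectableRegion S M) :
    S ⊔ (sympDual S ⊓ supportedOn Mᶜ) = sympDual S :=
  sup_sympDual_inf_supportedOn_compl_eq hself hM.inf_le

/-- **The integer form of the tradeoff on the torus.** For a stabilizer code with `k ≥ 1` on `(ℤ/L)^D`, `D ≥ 2`,
spanned by generators of range `t + 1` (`t ≥ 1`), there are a region `Y` onto which every logical operator can be
cleaned and a length `M ≥ 1` with `|Y| · M ≤ 6tD · n` and `d ≤ C_B(t,D) · M^{D−1}`.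
[cite: HaahPreskill2012, §4 proof of Thm. 1 («d̃ ≤ |M^c| ≤ (w−1)D L^D/[l+(w−1)]», «l < (d/4(w−1)D)^{1/(D−1)}»)] -/
theorem exists_region {k d t : ℕ} (hD : 2 ≤ D) (ht : 1 ≤ t) (e : Fin n ≃ (Fin D → Fin L))
    {S : Submodule (ZMod 2) (SympVec n)} (hloc : HasLocalGeneratorsPeriodic e (t + 1) S)
    (hcode : IsAdditiveCode S k d) (hk : 1 ≤ k) :
    ∃ (Y : Finset (Fin n)) (M : ℕ), S ⊔ (sympDual S ⊓ supportedOn Y) = sympDual S ∧ 1 ≤ M ∧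
      #Y * M ≤ 6 * t * D * n ∧
      d ≤ (4 * t * D * 2 ^ (D - 1) + (6 * t) ^ D + 4 * t * D * (7 * t) ^ (D - 1) + 1) * M ^ (D - 1) := by
  set CB := 4 * t * D * 2 ^ (D - 1) + (6 * t) ^ D + 4 * t * D * (7 * t) ^ (D - 1) + 1 with hCB
  have hn : n = L ^ D := by
    have h := Fintype.card_congr e
    simpa using h
  have hCA1 : 1 ≤ 6 * t * D := by nlinarith
  have huniv : #(univ : Finset (Fin n)) = n := by rw [card_univ, Fintype.card_fin]
  have triv : ∀ {B : ℕ}, d ≤ B → B ≤ CB →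
      ∃ (Y : Finset (Fin n)) (M : ℕ), S ⊔ (sympDual S ⊓ supportedOn Y) = sympDual S ∧ 1 ≤ M ∧
        #Y * M ≤ 6 * t * D * n ∧ d ≤ CB * M ^ (D - 1) := by
    intro B hdB hB
    refine ⟨univ, 1, sup_inf_supportedOn_univ hcode.1, le_rfl, ?_, ?_⟩
    · rw [huniv, mul_one]
      exact Nat.le_mul_of_pos_left n hCA1
    · rw [one_pow, mul_one]; exact hdB.trans hB
  have hkn : k ≤ n := by have := hcode.2.1; omega
  have hn1 : 1 ≤ n := hk.trans hkn
  have hL : 0 < L := by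
    rcases Nat.eq_zero_or_pos L with h | h
    · exfalso; rw [h, zero_pow (by omega)] at hn; omega
    · exact h
  -- the local generators
  set T : Set (SympVec n) := {v | v ∈ S ∧ IsCubeLocalPeriodic e (t + 1) v} with hT
  have hS : S = Submodule.span (ZMod 2) (Set.range (Subtype.val : T → SympVec n)) := by
    rw [Subtype.range_coe]
    exact le_antisymm hloc (Submodule.span_le.2 fun v hv => hv.1)
  have hg : ∀ a : T, IsCubeLocalPeriodic e (t + 1) (a : SympVec n) := fun a => a.2.2
  -- d ≤ 1
  rcases Nat.lt_or_ge d 2 with hd | hd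
  · exact triv (B := 1) (by omega) (by omega)
  -- d ≤ n (cleaning with the empty region)
  have hdn : d ≤ n := by
    have h := dist_le_card_compl_of_isCorrectableRegion hcode hk
      (IsCorrectableRegion.of_card_lt hcode.2.2.1 (M := (∅ : Finset (Fin n))) (by simp; omega))
    simpa using h
  -- tiny torus
  by_cases hLt : L < 6 * t
  · refine triv hdn ?_
    have : L ^ D ≤ (6 * t) ^ D := Nat.pow_le_pow_left hLt.le D
    rw [hn]; omega
  rw [not_lt] at hLt
  -- growth
  obtain ⟨R, hR1, hRL, hcube, halt⟩ := exists_correctable_cube hS hcode.1 hg hcode.2.2.1 hL ht hd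
  have hLD : L ^ (D - 1) * L = L ^ D := by rw [← pow_succ]; congr 1; omega
  rcases halt with hdR | hbig
  swap
  · -- the blocks have outgrown the torus: clean onto the complement of ONE hypercube
    set M₀ : Finset (Fin n) := cube e (fun _ => ⟨0, hL⟩) R with hM₀
    have hcorr : IsCorrectableRegion S M₀ := hcube _
    have hcard : #M₀ᶜ = n - R ^ D := by
      rw [card_compl, Fintype.card_fin, hM₀, card_cube_eq hL _ hRL]
    have h2 : n - R ^ D ≤ L ^ D - (L - 2 * t) ^ D := by
      rw [hn]
      exact Nat.sub_le_sub_left (Nat.pow_le_pow_left (by omega) D) _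
    have h3 := pow_sub_pow_le L (L - 2 * t) (Nat.sub_le _ _) D
    have h23 : n - R ^ D ≤ 2 * t * (D * L ^ (D - 1)) := by
      rw [show L - (L - 2 * t) = 2 * t by omega] at h3
      exact h2.trans h3
    refine ⟨M₀ᶜ, L, sup_inf_supportedOn_compl_of_isCorrectableRegion hcode.1 hcorr, hL, ?_, ?_⟩
    · rw [hcard]
      calc (n - R ^ D) * L ≤ 2 * t * (D * L ^ (D - 1)) * L := Nat.mul_le_mul_right _ h23
        _ = 2 * t * D * (L ^ (D - 1) * L) := by ring
        _ = 2 * t * D * n := by rw [hLD, hn]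
        _ ≤ 6 * t * D * n := by gcongr; norm_num
    · have h1 := dist_le_card_compl_of_isCorrectableRegion hcode hk hcorr
      rw [hcard] at h1
      have hcb : 2 * t * D ≤ CB := by
        have h2D : 1 ≤ 2 ^ (D - 1) := Nat.one_le_two_pow
        have : 2 * t * D ≤ 4 * t * D * 2 ^ (D - 1) :=
          calc 2 * t * D ≤ 4 * t * D := Nat.mul_le_mul_right _ (by omega)
            _ = 4 * t * D * 1 := (mul_one _).symm
            _ ≤ 4 * t * D * 2 ^ (D - 1) := Nat.mul_le_mul_left _ h2D
        omega
      calc d ≤ n - R ^ D := h1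
        _ ≤ 2 * t * (D * L ^ (D - 1)) := h23
        _ = (2 * t * D) * L ^ (D - 1) := by ring
        _ ≤ CB * L ^ (D - 1) := Nat.mul_le_mul_right _ hcb
  · -- the frame count has reached d: d ≤ 4tD (R+2t)^(D-1)
    have hd4 : d ≤ 4 * t * (D * (R + 2 * t) ^ (D - 1)) :=
      hdR.trans ((pow_sub_pow_le _ _ (by omega) D).trans (Nat.mul_le_mul_right _ (by omega)))
    by_cases hR5 : R < 5 * t
    · refine triv hd4 ?_
      have : (R + 2 * t) ^ (D - 1) ≤ (7 * t) ^ (D - 1) := Nat.pow_le_pow_left (by omega) _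
      calc 4 * t * (D * (R + 2 * t) ^ (D - 1)) ≤ 4 * t * (D * (7 * t) ^ (D - 1)) := by gcongr
        _ = 4 * t * D * (7 * t) ^ (D - 1) := by ring
        _ ≤ CB := by omega
    rw [not_lt] at hR5
    -- the partition with Q = ⌈L/p⌉ near-equal periods, p = R + t
    set p := R + t with hp
    have hp0 : 0 < p := by omega
    set Q := (L + p - 1) / p with hQdef
    have hQ1 : 1 ≤ Q := by
      rw [hQdef, Nat.le_div_iff_mul_le hp0]; omega
    have hdm := Nat.div_add_mod (L + p - 1) p
    have hml := Nat.mod_lt (L + p - 1) hp0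
    have hLQ : L ≤ Q * p := by
      have : p * ((L + p - 1) / p) = Q * p := by rw [hQdef]; ring
      omega
    have hQp : Q * p < L + p := by
      have : p * ((L + p - 1) / p) = Q * p := by rw [hQdef]; ring
      omega
    have hQone : L ≤ p → Q = 1 := by
      intro hpL
      have : Q < 2 := by
        by_contra h
        rw [not_lt] at h
        have : 2 * p ≤ Q * p := Nat.mul_le_mul_right _ h
        omega
      omega
    have h2Q : 2 * t * Q ≤ L := by
      rcases Nat.lt_or_ge p L with hpL | hpL
      · have h1 : 2 * t * (L + p) ≤ L * p :=
          calc 2 * t * (L + p) ≤ 2 * t * (L + L) := Nat.mul_le_mul_left _ (by omega)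
            _ = (4 * t) * L := by ring
            _ ≤ p * L := Nat.mul_le_mul_right _ (by omega)
            _ = L * p := by ring
        have h3 : 2 * t * Q * p < L * p :=
          calc 2 * t * Q * p = 2 * t * (Q * p) := by ring
            _ < 2 * t * (L + p) := Nat.mul_lt_mul_of_pos_left hQp (by omega)
            _ ≤ L * p := h1
        exact le_of_lt (Nat.lt_of_mul_lt_mul_right h3)
      · rw [hQone hpL]; omega
    have hQ0 : 0 < Q := hQ1
    -- the region Y = M^c and its cleaning property
    set Y : Finset (Fin n) := univ.filter fun q => InCorridor e Q t q with hYdef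
    have hX := isCorrectableRegion_blocks (e := e) (Q := Q) (t := t) hS hg hQ0 hL hLQ hcube
    have hYc : (univ.filter fun q => ¬ InCorridor e Q t q)ᶜ = Y := by
      ext q; simp [hYdef]
    have hclean : S ⊔ (sympDual S ⊓ supportedOn Y) = sympDual S := by
      rw [← hYc]
      exact sup_inf_supportedOn_compl_of_isCorrectableRegion hcode.1 hX
    have hYcard : #Y ≤ D * (3 * t * Q) * L ^ (D - 1) :=
      card_filter_inCorridor_le (e := e) hQ0 hL h2Q
    rcases Nat.lt_or_ge p L with hpL | hpL
    · -- at least one full period: M = p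
      refine ⟨Y, p, hclean, hp0, ?_, ?_⟩
      · have hQp2 : Q * p ≤ 2 * L := by omega
        calc #Y * p ≤ D * (3 * t * Q) * L ^ (D - 1) * p := Nat.mul_le_mul_right _ hYcard
          _ = 3 * t * D * (Q * p) * L ^ (D - 1) := by ring
          _ ≤ 3 * t * D * (2 * L) * L ^ (D - 1) := by gcongr
          _ = 6 * t * D * (L ^ (D - 1) * L) := by ring
          _ = 6 * t * D * n := by rw [hLD, hn]
      · have h1 : (R + 2 * t) ^ (D - 1) ≤ (2 * p) ^ (D - 1) := Nat.pow_le_pow_left (by omega) _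
        calc d ≤ 4 * t * (D * (R + 2 * t) ^ (D - 1)) := hd4
          _ ≤ 4 * t * (D * (2 * p) ^ (D - 1)) := by gcongr
          _ = (4 * t * D * 2 ^ (D - 1)) * p ^ (D - 1) := by rw [mul_pow]; ring
          _ ≤ CB * p ^ (D - 1) := Nat.mul_le_mul_right _ (by omega)
    · -- less than one period: M = L
      have hQ1' := hQone hpL
      refine ⟨Y, L, hclean, hL, ?_, ?_⟩
      · calc #Y * L ≤ D * (3 * t * Q) * L ^ (D - 1) * L := Nat.mul_le_mul_right _ hYcard
          _ = 3 * t * D * Q * (L ^ (D - 1) * L) := by ring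
          _ = 3 * (t * D * n) := by rw [hLD, hn, hQ1']; ring
          _ ≤ 6 * (t * D * n) := Nat.mul_le_mul_right _ (by norm_num)
          _ = 6 * t * D * n := by ring
      · have h1 : (R + 2 * t) ^ (D - 1) ≤ (2 * L) ^ (D - 1) := Nat.pow_le_pow_left (by omega) _
        calc d ≤ 4 * t * (D * (R + 2 * t) ^ (D - 1)) := hd4
          _ ≤ 4 * t * (D * (2 * L) ^ (D - 1)) := by gcongr
          _ = (4 * t * D * 2 ^ (D - 1)) * L ^ (D - 1) := by rw [mul_pow]; ring
          _ ≤ CB * L ^ (D - 1) := Nat.mul_le_mul_right _ (by omega)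

/-- **From the integer inequalities to the exponent `1/(D−1)`**: `|Y|·M ≤ C_A n` and `d ≤ C_B M^{D−1}` give
`|Y|·d^{1/(D−1)} ≤ C_A C_B^{1/(D−1)}·n`. [cite: HaahPreskill2012, Thm. 1 («d̃ d^{1/(D−1)} < c L^D»)] -/
theorem real_step {D Y d n M CA CB : ℕ} (hD : 2 ≤ D) (h1 : Y * M ≤ CA * n) (h2 : d ≤ CB * M ^ (D - 1)) :
    (Y : ℝ) * (d : ℝ) ^ ((1 : ℝ) / ((D : ℝ) - 1)) ≤
      (CA : ℝ) * (CB : ℝ) ^ ((1 : ℝ) / ((D : ℝ) - 1)) * n := by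
  have hD1 : (0 : ℝ) < (D : ℝ) - 1 := by
    have : (2 : ℝ) ≤ D := by exact_mod_cast hD
    linarith
  set α : ℝ := 1 / ((D : ℝ) - 1) with hα
  have hα0 : 0 ≤ α := by positivity
  have hd' : (d : ℝ) ≤ (CB : ℝ) * (M : ℝ) ^ (D - 1) := by exact_mod_cast h2
  have hpow : ((M : ℝ) ^ (D - 1)) ^ α = (M : ℝ) := by
    rw [← Real.rpow_natCast (M : ℝ) (D - 1), ← Real.rpow_mul (Nat.cast_nonneg M)]
    have : ((D - 1 : ℕ) : ℝ) * α = 1 := by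
      rw [Nat.cast_sub (by omega), Nat.cast_one, hα]
      field_simp
    rw [this, Real.rpow_one]
  have hdα : (d : ℝ) ^ α ≤ (CB : ℝ) ^ α * (M : ℝ) := by
    calc (d : ℝ) ^ α ≤ ((CB : ℝ) * (M : ℝ) ^ (D - 1)) ^ α :=
          Real.rpow_le_rpow (Nat.cast_nonneg d) hd' hα0
      _ = (CB : ℝ) ^ α * ((M : ℝ) ^ (D - 1)) ^ α := Real.mul_rpow (Nat.cast_nonneg CB) (by positivity)
      _ = (CB : ℝ) ^ α * (M : ℝ) := by rw [hpow]
  have h1' : (Y : ℝ) * (M : ℝ) ≤ (CA : ℝ) * n := by exact_mod_cast h1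
  calc (Y : ℝ) * (d : ℝ) ^ α ≤ (Y : ℝ) * ((CB : ℝ) ^ α * (M : ℝ)) :=
        mul_le_mul_of_nonneg_left hdα (Nat.cast_nonneg Y)
    _ = (CB : ℝ) ^ α * ((Y : ℝ) * (M : ℝ)) := by ring
    _ ≤ (CB : ℝ) ^ α * ((CA : ℝ) * n) := mul_le_mul_of_nonneg_left h1' (by positivity)
    _ = (CA : ℝ) * (CB : ℝ) ^ α * n := by ring

/-- A code without logical qubits has `S̄⊥ = S̄`: nothing to clean (`Y = ∅`). [folklore] -/
private theorem sympDual_eq_of_k_zero {S : Submodule (ZMod 2) (SympVec n)} {d : ℕ} (hcode : IsAdditiveCode S 0 d) :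
    sympDual S = S := by
  symm
  refine Submodule.eq_of_le_of_finrank_le hcode.1 ?_
  rw [hcode.finrank_sympDual]
  have := hcode.2.1
  omega

end Assembly

end

end HPTradeoff

/-! ### The theorems -/

/-- **Haah–Preskill 2012, Theorem 1, for stabilizer codes on the `D`-dimensional torus — proved.** «For a local
subsystem code in `D ≥ 2` dimensions with interaction range `w > 1` and distance `d ≫ w`, defined on a hypercubic
lattice with linear size `L`, every dressed logical operator is equivalent to an operator with weight `d̃`
satisfying `d̃ d^{1/(D−1)} < c L^D`, where `c` is a constant depending on `w` and `D`.» Typed for STABILIZER codes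
(gauge group = stabilizer group; dressed logical operators = `S̄⊥ ∖ S̄`, equivalence = modulo `S̄`) on qubits placed
by `e` on `(ℤ/L)^D` with stabilizer space spanned by generators each inside a hypercube with `w^D` vertices taken
modulo `L`, in the uniform form the printed proof yields: there is ONE region `Y` (the complement of the union of
the correctable hypercubes) with `S̄ ⊔ (S̄⊥ ⊓ 𝒫(Y)) = S̄⊥` — every logical class has a representative supported
on `Y` — and `|Y| · d^{1/(D−1)} ≤ c(w, D) · n`; no hypothesis `d ≫ w` is needed with an existential constant.
Column: proved theorem. -- TODO(general form): subsystem codes with non-abelian gauge group; commuting-projector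
-- codes (Thm. 2).
[cite: HaahPreskill2012, Thm. 1 (§4) with its proof («x̃ … supported on the complement of the union of hypercubes»), setting of §2 («open or periodic boundary conditions»)] -/
theorem HaahPreskill2012_theorem1_stabilizer_torus (D w : ℕ) (hD : 2 ≤ D) :
    ∃ c : ℝ, 0 < c ∧ ∀ (L n k d : ℕ) (e : Fin n ≃ (Fin D → Fin L)) (S : Submodule (ZMod 2) (SympVec n)),
      HasLocalGeneratorsPeriodic e w S → IsAdditiveCode S k d →
        ∃ Y : Finset (Fin n), S ⊔ (sympDual S ⊓ supportedOn Y) = sympDual S ∧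
          (#Y : ℝ) * (d : ℝ) ^ ((1 : ℝ) / ((D : ℝ) - 1)) ≤ c * n := by
  classical
  obtain ⟨t, ht, hwt⟩ : ∃ t : ℕ, 1 ≤ t ∧ w ≤ t + 1 := ⟨max w 2 - 1, by omega, by omega⟩
  refine ⟨((6 * t * D : ℕ) : ℝ) *
      ((4 * t * D * 2 ^ (D - 1) + (6 * t) ^ D + 4 * t * D * (7 * t) ^ (D - 1) + 1 : ℕ) : ℝ) ^
        ((1 : ℝ) / ((D : ℝ) - 1)), ?_, ?_⟩
  · have hCA : (0 : ℝ) < ((6 * t * D : ℕ) : ℝ) := by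
      exact_mod_cast (show 0 < 6 * t * D by nlinarith)
    have hCB : (0 : ℝ) < ((4 * t * D * 2 ^ (D - 1) + (6 * t) ^ D + 4 * t * D * (7 * t) ^ (D - 1) + 1 : ℕ) : ℝ) := by
      exact_mod_cast Nat.succ_pos _
    positivity
  · intro L n k d e S hloc hcode
    rcases Nat.eq_zero_or_pos k with hk | hk
    · subst hk
      refine ⟨∅, ?_, ?_⟩
      · rw [HPTradeoff.sympDual_eq_of_k_zero hcode]
        exact sup_eq_left.2 inf_le_left
      · rw [card_empty, Nat.cast_zero, zero_mul]
        positivity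
    · obtain ⟨Y, M, hclean, -, h1, h2⟩ := HPTradeoff.exists_region hD ht e (hloc.mono hwt) hcode hk
      exact ⟨Y, hclean, HPTradeoff.real_step hD h1 h2⟩

/-- **Haah–Preskill 2012, Theorem 1, stabilizer codes on the torus — the printed per-operator reading**: every
logical operator `E ∈ S̄⊥` is equivalent modulo `S̄` to an operator `E'` of weight `d̃ = wt(E')` with
`d̃ · d^{1/(D−1)} ≤ c(w, D) · n`. [cite: HaahPreskill2012, Thm. 1 (§4: «every dressed logical operator is equivalent to an operator with weight d̃ satisfying d̃ d^{1/(D−1)} < c L^D»)] -/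
theorem HaahPreskill2012_theorem1_stabilizer_torus' (D w : ℕ) (hD : 2 ≤ D) :
    ∃ c : ℝ, 0 < c ∧ ∀ (L n k d : ℕ) (e : Fin n ≃ (Fin D → Fin L)) (S : Submodule (ZMod 2) (SympVec n)),
      HasLocalGeneratorsPeriodic e w S → IsAdditiveCode S k d →
        ∀ E ∈ sympDual S, ∃ E' ∈ sympDual S, E' - E ∈ S ∧
          (sympWeight E' : ℝ) * (d : ℝ) ^ ((1 : ℝ) / ((D : ℝ) - 1)) ≤ c * n := by
  obtain ⟨c, hc, h⟩ := HaahPreskill2012_theorem1_stabilizer_torus D w hD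
  refine ⟨c, hc, fun L n k d e S hloc hcode E hE => ?_⟩
  obtain ⟨Y, hclean, hY⟩ := h L n k d e S hloc hcode
  have hE' : E ∈ S ⊔ (sympDual S ⊓ supportedOn Y) := by rw [hclean]; exact hE
  obtain ⟨s, hs, E', ⟨hE'd, hE'Y⟩, rfl⟩ := Submodule.mem_sup.1 hE'
  refine ⟨E', hE'd, ?_, ?_⟩
  · have : E' - (s + E') = -s := by abel
    rw [this]
    exact S.neg_mem hs
  · calc (sympWeight E' : ℝ) * (d : ℝ) ^ ((1 : ℝ) / ((D : ℝ) - 1))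
        ≤ (#Y : ℝ) * (d : ℝ) ^ ((1 : ℝ) / ((D : ℝ) - 1)) := by
          refine mul_le_mul_of_nonneg_right ?_ (by positivity)
          exact_mod_cast sympWeight_le_card_of_mem hE'Y
      _ ≤ c * n := hY

/-- **Haah–Preskill 2012, Theorem 1, stabilizer codes with open boundary conditions** (`Λ = {1,…,L}^D`, generators
inside hypercubes with `w^D` vertices): the same region `Y` and bound, an open-boundary hypercube being contained in
the periodic one with the same corner. [cite: HaahPreskill2012, Thm. 1 (§4) with §2 («with either open or periodic boundary conditions»)] -/
theorem HaahPreskill2012_theorem1_stabilizer (D w : ℕ) (hD : 2 ≤ D) :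
    ∃ c : ℝ, 0 < c ∧ ∀ (L n k d : ℕ) (e : Fin n ≃ (Fin D → Fin L)) (S : Submodule (ZMod 2) (SympVec n)),
      HasLocalGenerators e w S → IsAdditiveCode S k d →
        ∃ Y : Finset (Fin n), S ⊔ (sympDual S ⊓ supportedOn Y) = sympDual S ∧
          (#Y : ℝ) * (d : ℝ) ^ ((1 : ℝ) / ((D : ℝ) - 1)) ≤ c * n := by
  obtain ⟨c, hc, h⟩ := HaahPreskill2012_theorem1_stabilizer_torus D w hD
  exact ⟨c, hc, fun L n k d e S hloc hcode => h L n k d e S hloc.toPeriodic hcode⟩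

/-- **`D = 2`: `d̃ · d ≤ c n`** («For `D = 2` the tradeoff becomes `d d̃ = O(L²)`»): on the `L × L` torus every
logical class of a stabilizer code with range-`w` generators has a representative on a region `Y` with
`|Y| · d ≤ c(w) · n`. [cite: HaahPreskill2012, §1 («For D=2 the tradeoff becomes d d̃ = O(L²), and hence d = O(L)») and Thm. 1] -/
theorem HaahPreskill2012_theorem1_stabilizer_torus_two (w : ℕ) :
    ∃ c : ℝ, 0 < c ∧ ∀ (L n k d : ℕ) (e : Fin n ≃ (Fin 2 → Fin L)) (S : Submodule (ZMod 2) (SympVec n)),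
      HasLocalGeneratorsPeriodic e w S → IsAdditiveCode S k d →
        ∃ Y : Finset (Fin n), S ⊔ (sympDual S ⊓ supportedOn Y) = sympDual S ∧ (#Y : ℝ) * (d : ℝ) ≤ c * n := by
  obtain ⟨c, hc, h⟩ := HaahPreskill2012_theorem1_stabilizer_torus 2 w le_rfl
  refine ⟨c, hc, fun L n k d e S hloc hcode => ?_⟩
  obtain ⟨Y, hclean, hY⟩ := h L n k d e S hloc hcode
  have hexp : (1 : ℝ) / (((2 : ℕ) : ℝ) - 1) = ((1 : ℕ) : ℝ) := by norm_num
  rw [hexp, Real.rpow_natCast, pow_one] at hY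
  exact ⟨Y, hclean, hY⟩

end Literature.InformationTheory.QuantumCodes
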